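import Summits.BirchSwinnertonDyer.BirchSwinnertonDyer.Theorems.UniversalToricDescentDefectTransportWallStep
import HarnessLib

/-!
# Route UniversalToricDescent — the `μ`-part of ♭T's algebraic half is UNCONDITIONAL in (iv):
# `X_{∅,0}(E)` torsion + the wall inclusion at `𝓛` + `μ(𝓛) = 0` ⟹ `X_{∅,0}(E′)` torsion with `μ = 0` and
# generators of both characteristic ideals with norm profiles `λ_alg(E)`, `λ_alg(E′)` — on ALL classes

Lead prover bsd-wall-utd-p1 g11 (`--supports` ♭T stmt-BirchSwinnertonDyer-26042; answer to vet tk5d g10's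
F9 note on (iv)). The λ-COUNT half of the algebraic side of ♭T (`defectTransport_algebraicHalf_lambda[_of_wall]`)
uses (iv) `E(ℚ₃)[3] = 0` three times (the local lemma (L) of the exact residual comparison, (N1), and the
Cor. (2.3) product) and is therefore void on the 206 split-type classes with `E(ℚ₃)[3] ≠ 0`. The TORSION / `μ = 0`
half is not: the tree's finiteness-form residual comparison
(`UniversalToricDescentResidualSelmerTransfer.finite_selmerAc_pTorsion_transfer_of_torsionIso`, g6, "UNCONDITIONAL
in the local lemma") and `torsionMuTransport_of_heegner` need no (iv), no Poitou–Tate and no base finiteness.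
Composed with the wall step (`muInvariant_eq_zero_of_span_le_map_charIdeal`) in the `E → E′` direction of act D:

* **`defectTransport_torsionMu_of_wall`** — ♭T binders (`E` O6-additive at `3`, `3 ∣ N` so the datum is
  automatic; mod-`3` twin `E′`; Heegner `K` for `N, N′`; anticyclotomic `κ`, `γ`, `𝔭′ ∋ 3`), `X_{∅,0}(E/K_∞)`
  torsion, `(𝓛) ⊆ Ch(E)·R₀⟦T⟧`, a norm-one coefficient of `𝓛` ⟹ `μ(X_{∅,0}(E)) = 0` ∧ `X_{∅,0}(E′/K_∞)` torsion
  ∧ `μ(X_{∅,0}(E′)) = 0` ∧ generators `g, g′` of `Ch(E)·R₀⟦T⟧, Ch(E′)·R₀⟦T⟧` with norm profiles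
  `λ_alg(E)`, `λ_alg(E′)` — NO (iv), NO Poitou–Tate, NO base finiteness.

So of ♭T's conclusion `∃ g g′ n m n′ m′, …` everything but the identity `n + m′ = n′ + m` is available on every
class from ♭T's hypotheses + `μ(𝓛_E) = 0`; the identity itself is the analytic half + the λ-count (whose (iv)
the vet proposes to retire by a residual-invariance argument at `𝔭′` — three engine patches + a local-global
surjectivity at `𝔭′`, recorded in the cell's HANDOFF § utd-p1 g11). THEOREMS ONLY; no definition, no named
fact, no `sorry`. BSD is not advanced by this file.
References: [GreenbergVatsal2000] Thm. (1.4), §2 Prop. (2.8); [Brink2007] Thm. 2, Cor. 1; [Washington1997] §13.2.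
-/

set_option autoImplicit false
-- `…BirchSwinnertonDyer.BirchSwinnertonDyer.Theorems…` is the problem's mandated namespace (D-0017).
set_option linter.dupNamespace false

noncomputable section

open scoped Classical

namespace Summit.BirchSwinnertonDyer.BirchSwinnertonDyer.Theorems.UniversalToricDescentDefectTransport

open Function Field NumberField IsDedekindDomain WeierstrassCurve
open Literature.NumberTheory.GaloisRepresentations Literature.NumberTheory.EllipticCurves
  Literature.NumberTheory.EllipticCurves.GreenbergSelmer Literature.NumberTheory.GaloisCohomology
  Literature.NumberTheory.EllipticCurves.IwasawaAlgebra Literature.NumberTheory.EllipticCurves.Rank1Residual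
  Summit.BirchSwinnertonDyer.Rank1Residual Summit.BirchSwinnertonDyer.Rank1Residual.X11b
  Summit.BirchSwinnertonDyer.Rank1Residual.X11b.Coinv Summit.BirchSwinnertonDyer.Rank1Residual.X11b.AcSelmer
  Summit.BirchSwinnertonDyer.Rank1Residual.Iwasawa
  Summit.BirchSwinnertonDyer.BirchSwinnertonDyer.Theorems.UniversalToricDescentAcDualMuZero
  Summit.BirchSwinnertonDyer.BirchSwinnertonDyer.Theorems.UniversalToricDescentLambdaNormProfile
  Summit.BirchSwinnertonDyer.BirchSwinnertonDyer.Theorems.UniversalToricDescentTorsionMuTransportHeegner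
  Summit.BirchSwinnertonDyer.BirchSwinnertonDyer.Theorems.UniversalToricDescentTowerTorsion

/-- **The `μ`-part of ♭T's algebraic half, direction `E → E′`, on ALL classes (no (iv), no Poitou–Tate, no
base finiteness).** From `X_{∅,0}(E/K_∞)` torsion, the wall's inclusion `(𝓛) ⊆ Ch(E)·R₀⟦T⟧` and a norm-one
coefficient of `𝓛`: `μ(X_{∅,0}(E)) = 0`, `X_{∅,0}(E′/K_∞)` is torsion with `μ = 0`, and both characteristic
ideals have generators with norm profiles `λ_alg(E)`, `λ_alg(E′)`. Chain: wall step; `Sel^∅(E)[3]` finite ⟹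
`Sel^∅(E′)[3]` finite by the finiteness-form residual comparison along `E[3] ≅ E′[3]`
(`torsionMuTransport_of_heegner`, symmetric in the two curves via `modPCongruent_symm`); `Λ`-side criteria.
[cite: GreenbergVatsal2000, Thm. (1.4), §2 Prop. (2.8)] [cite: Brink2007, Thm. 2 and Cor. 1] -/
theorem defectTransport_torsionMu_of_wall (W W' : WeierstrassCurve ℚ) [W.IsElliptic]
    [W'.IsElliptic] {N N' : ℕ} (K : Type) [Field K] [NumberField K]
    (hN : W.conductorNorm ℤ = N) (hcong : O6.ModPCongruent W' W 3)
    (hN' : W'.conductorNorm ℤ = N') (hK : IsImaginaryQuadratic K)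
    (hHe : SatisfiesHeegnerHypothesis N K) (hHe' : SatisfiesHeegnerHypothesis N' K)
    (κ : ZpExtension K 3) (hκ : κ.IsAnticyclotomic) (γ : absoluteGaloisGroup K)
    [Fact (κ.IsTopGenerator γ)] {𝔭' : HeightOneSpectrum (𝓞 K)} (h𝔭' : ((3 : ℕ) : 𝓞 K) ∈ 𝔭'.asIdeal)
    (hT : Module.IsTorsion (IwasawaAlgebra 3) (XAc (W.baseChange K) 3 κ 𝔭' ∅ γ))
    {L : UnrSeries 3}
    (hle : Ideal.span {L} ≤
      (XAc.charIdeal (W.baseChange K) 3 κ 𝔭' ∅ γ).map (PowerSeries.map (Halves.toUnr 3)))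
    (hi : ∃ i : ℕ, ‖((PowerSeries.coeff i L : unrIntegers 3) : ℂ_[3])‖ = 1) :
    muInvariant 3 (XAc (W.baseChange K) 3 κ 𝔭' ∅ γ) = 0 ∧
      (∃ g : UnrSeries 3,
        (XAc.charIdeal (W.baseChange K) 3 κ 𝔭' ∅ γ).map (PowerSeries.map (Halves.toUnr 3)) =
            Ideal.span {g} ∧
          (∀ i < lambdaInvariant 3 (XAc (W.baseChange K) 3 κ 𝔭' ∅ γ),
            ‖((PowerSeries.coeff i g : unrIntegers 3) : ℂ_[3])‖ < 1) ∧
          ‖((PowerSeries.coeff (lambdaInvariant 3 (XAc (W.baseChange K) 3 κ 𝔭' ∅ γ)) g :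
            unrIntegers 3) : ℂ_[3])‖ = 1) ∧
      Module.IsTorsion (IwasawaAlgebra 3) (XAc (W'.baseChange K) 3 κ 𝔭' ∅ γ) ∧
      muInvariant 3 (XAc (W'.baseChange K) 3 κ 𝔭' ∅ γ) = 0 ∧
      (∃ g' : UnrSeries 3,
        (XAc.charIdeal (W'.baseChange K) 3 κ 𝔭' ∅ γ).map (PowerSeries.map (Halves.toUnr 3)) =
            Ideal.span {g'} ∧
          (∀ i < lambdaInvariant 3 (XAc (W'.baseChange K) 3 κ 𝔭' ∅ γ),
            ‖((PowerSeries.coeff i g' : unrIntegers 3) : ℂ_[3])‖ < 1) ∧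
          ‖((PowerSeries.coeff (lambdaInvariant 3 (XAc (W'.baseChange K) 3 κ 𝔭' ∅ γ)) g' :
            unrIntegers 3) : ℂ_[3])‖ = 1) := by
  haveI : Fact (Nat.Prime 3) := ⟨Nat.prime_three⟩
  haveI := XAc.module_finite κ 𝔭' (∅ : Set (HeightOneSpectrum (𝓞 K))) γ Set.finite_empty
    (W := W.baseChange K)
  haveI := XAc.module_finite κ 𝔭' (∅ : Set (HeightOneSpectrum (𝓞 K))) γ Set.finite_empty
    (W := W'.baseChange K)
  -- the wall step: `μ(X_E) = 0`, and a generator with profile `λ_alg(E)`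
  have hμ : muInvariant 3 (XAc (W.baseChange K) 3 κ 𝔭' ∅ γ) = 0 :=
    muInvariant_eq_zero_of_span_le_map_charIdeal (XAc (W.baseChange K) 3 κ 𝔭' ∅ γ) hT hle hi
  obtain ⟨g, hg, hglt, hgeq⟩ :=
    exists_generator_normProfile_lambdaInvariant (W.baseChange K) 3 κ 𝔭' ∅ γ Set.finite_empty hT hμ
  -- torsion + a generator with a unit coefficient transport to the twin, no (iv)
  obtain ⟨hT', g₁, hg₁, hi₁⟩ := torsionMuTransport_of_heegner W' W K (by norm_num) hN'
    (modPCongruent_symm 3 W W' hcong) hN hK hHe' hHe κ hκ γ 𝔭' h𝔭' hT ⟨g, hg, _, hgeq⟩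
  have hμ' : muInvariant 3 (XAc (W'.baseChange K) 3 κ 𝔭' ∅ γ) = 0 :=
    muInvariant_eq_zero_of_map_charIdeal_eq_span (XAc (W'.baseChange K) 3 κ 𝔭' ∅ γ) hT' hg₁ hi₁
  obtain ⟨g', hg', hglt', hgeq'⟩ :=
    exists_generator_normProfile_lambdaInvariant (W'.baseChange K) 3 κ 𝔭' ∅ γ Set.finite_empty hT' hμ'
  exact ⟨hμ, ⟨g, hg, hglt, hgeq⟩, hT', hμ', ⟨g', hg', hglt', hgeq'⟩⟩

end Summit.BirchSwinnertonDyer.BirchSwinnertonDyer.Theorems.UniversalToricDescentDefectTransport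

end
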